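import Summits.AtomisticToContinuum.HydrodynamicLimit.Theorems.KineticCurrentsWindowLDUniform.Negative.ForallN
import Summits.AtomisticToContinuum.HydrodynamicLimit.Theorems.KineticCurrentsWindowLDUniform.Negative.TiltWindow
import Summits.AtomisticToContinuum.HydrodynamicLimit.Theorems.BoltzmannGreenKubo.Negative.EnergyWitness
import Summits.AtomisticToContinuum.HydrodynamicLimit.Theorems.OneFlightGossipEngineKineticCurrentsWindowLDUniformClassTruncationGauss

/-!
# `KineticCurrentsWindowLDUniform`: `∃ β₀` (small `β`) and `⊥ v_j` are load-bearing — two refuted variants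

Negative knowledge for the crux `OneFlightGossipEngine.KineticCurrentsWindowLDUniform`
(stmt-AtomisticToContinuum-14662), from the standing disprover's `Cruxes/KineticCurrentsWindowLDUniform/Disproof.lean`
§§ 3–4, using the drift-tilt lower bound of `Negative/TiltWindow.lean` (Donsker–Varadhan with drifted, flow-INVARIANT
homogeneous Gibbs laws) and the shear-stress witness of `Negative/ForallN.lean`.

* `KineticCurrentsWindowLDUniformAllBeta` — the crux VERBATIM with `∃ β₀ > 0, ∀ |β| ≤ β₀` strengthened to `∀ β` — is
  FALSE: for `a = θ₀ = 1`, `u₀ = 0`, `F = v₀v₁` and `β = 2 > 1 = 1/(2θ₀λ_max(A_sym))` the window functional is `+∞`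
  for EVERY `N`, flow and window (`KineticCurrentsWindowTilt.lintegral_exp_shear_window_eq_top`: drifts `(s,s,0)`,
  gain `βs²` against entropy `s²` per particle, `s → ∞`), so no `τ, N₀` can bring it below `e^{ε(N+1)}`.
  Hence `β₀` is load-bearing and QUANTITATIVELY `β₀ ≤ 1/(2 sup θ₀ · λ_max(A_sym))`: time averaging over kinetic
  windows does not enlarge the static domain of finiteness of `Λ(β)`, uniformly in `τ` — a proof whose admissible
  `β`-range grows with `τ` is wrong.
* `KineticCurrentsWindowLDUniformWithoutOrthMom` — the crux VERBATIM with the hypothesis `F ⊥ v_j` DELETED — is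
  FALSE: `F = v₀ = (e₀·w)·1` (`A = 0`, `b = e₀`, `G ≡ 1`; continuous, `|F| ≤ 1+‖v‖²`, `⊥ 1` and `⊥ ‖v‖²` by
  oddness) has `∫ exp(β ∑ᵢ w⁻¹∫₀ʷ v_{i,0}) dG_N ≥ e^{(N+1)β²/2}` at EVERY window and `N`
  (`KineticCurrentsWindowTilt.exp_le_lintegral_exp_momentum_window`: drift `βe₀`), which beats `e^{ε(N+1)}` at
  `ε = β₀²/4`, `β = β₀`, whatever `β₀ > 0` is offered. (The momentum `P₀ = ∑ v_{i,0}` is conserved; the tilt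
  argument does not even use that — only invariance of the drifted Gibbs law.)
refuter-cdisprove-stmt-AtomisticToContinuum-14662-0.
-/

noncomputable section

namespace Summit.AtomisticToContinuum.HydrodynamicLimit.Theorems

open MeasureTheory ProbabilityTheory Real
open scoped ENNReal InnerProductSpace
open Literature.Analysis.FluidPDE Literature.MathematicalPhysics.KineticTheory

namespace KineticCurrentsWindowLDUniformLoadBearing

open KineticCurrentsWindowLDUniformOneSphere
open KineticCurrentsWindowTilt
open BoltzmannGreenKuboForallN (reflB reflB_apply integral_stdGaussian_eq_zero_of_odd norm_sq_eq_three)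

/-- The small reduced diameter used by all witnesses: `σ = min(1/4, η₀, 1)`. -/
def sigmaOf (η₀ : ℝ) : ℝ := min (1 / 4) (min η₀ 1)

/-- Properties of `sigmaOf η₀` for `η₀ > 0`: positive, `≤ 1/4`, `≤ η₀`, `≤ 1`. [folklore] -/
theorem sigmaOf_spec {η₀ : ℝ} (hη₀ : 0 < η₀) :
    0 < sigmaOf η₀ ∧ sigmaOf η₀ ≤ 1 / 4 ∧ sigmaOf η₀ ≤ η₀ ∧ sigmaOf η₀ ≤ 1 :=
  ⟨lt_min (by norm_num) (lt_min hη₀ one_pos), min_le_left _ _,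
    (min_le_right _ _).trans (min_le_left _ _), (min_le_right _ _).trans (min_le_right _ _)⟩

/-- The activity guard `σ³ · sup a ≤ η₀ ∫ a` holds for `a ≡ 1` and `σ = sigmaOf η₀`. [folklore] -/
theorem guard_sigmaOf {η₀ : ℝ} (hη₀ : 0 < η₀) :
    sigmaOf η₀ ^ 3 * (⨆ _x : T3, (1 : ℝ)) ≤ η₀ * ∫ _x : T3, (1 : ℝ) := by
  obtain ⟨hpos, -, hη, h1⟩ := sigmaOf_spec hη₀
  have hsup : (⨆ _x : T3, (1 : ℝ)) = 1 := ciSup_const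
  have hint : ∫ _x : T3, (1 : ℝ) = 1 := by simp
  rw [hsup, hint, mul_one, mul_one]
  calc sigmaOf η₀ ^ 3 ≤ sigmaOf η₀ := by
        have : sigmaOf η₀ ^ 3 ≤ sigmaOf η₀ ^ 1 := pow_le_pow_of_le_one hpos.le h1 (by norm_num)
        simpa using this
    _ ≤ η₀ := hη

/-! ### The witness `F = v₀` (no orthogonality to `v_j`) -/

/-- `A ≡ 0`. -/
def A0 : T3 → Fin 3 → Fin 3 → ℝ := fun _ _ _ => 0

/-- `b ≡ e₀`. -/
def bE0 : T3 → V3 := fun _ => EuclideanSpace.single 0 1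

/-- `G ≡ 1`. -/
def G1 : T3 × ℝ → ℝ := fun _ => 1

/-- The crux functional at `A = 0`, `b = e₀`, `G = 1`, `u₀ = 0` is the momentum component `v₀`
(stated in the beta-normal form the crux produces after instantiation). [folklore] -/
theorem F_mom (x : T3) (v : V3) :
    ((∑ j : Fin 3, ∑ k : Fin 3, A0 x j k * ((v - 0) j * (v - 0) k)) +
      (∑ j : Fin 3, bE0 x j * (v - 0) j) * G1 (x, ‖v - 0‖ ^ 2)) = v 0 := by
  simp [A0, bE0, G1]

/-- `|v₀| ≤ 1 · (1 + ‖v‖²)`. [folklore] -/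
theorem abs_coord_le (v : V3) : |v 0| ≤ 1 * (1 + ‖v‖ ^ 2) := by
  rw [one_mul, norm_sq_eq_three, abs_le]
  constructor <;> nlinarith [sq_nonneg (v 0 + 1), sq_nonneg (v 0 - 1), sq_nonneg (v 1), sq_nonneg (v 2)]

/-- `v₀ ⊥ 1` under the Maxwellian (odd under `v₀ ↦ -v₀`). [folklore] -/
theorem coord_orth_one : ∫ v, v 0 * localMaxwellian 1 1 (0 : V3) v = 0 := by
  rw [integral_mul_localMaxwellian_eq]
  exact integral_stdGaussian_eq_zero_of_odd (reflB 0) (G := fun v : V3 => v 0) fun w => by simp [reflB_apply]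

/-- `v₀ ⊥ ‖v‖²` under the Maxwellian (odd under `v₀ ↦ -v₀`, which preserves the norm). [folklore] -/
theorem coord_orth_energy : ∫ v, v 0 * ‖v‖ ^ 2 * localMaxwellian 1 1 (0 : V3) v = 0 := by
  rw [integral_mul_localMaxwellian_eq]
  refine integral_stdGaussian_eq_zero_of_odd (reflB 0) (G := fun v : V3 => v 0 * ‖v‖ ^ 2) fun w => ?_
  simp [reflB_apply]


/-! ### A Gaussian moment shared by the heat-flux and the `⊥1` witnesses -/

open BoltzmannGreenKuboOrthMomentum (integral_coord_pow_four integral_coord_mul_coord_of_ne)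
open KineticCurrentsWindowLDUniformSketch.ClassTruncation (integrable_of_le_cube)

/-- The mixed fourth moment `E[v₀² ‖v‖²] = 5` (`E v₀⁴ = 3`, `E v₀²v₁² = E v₀²v₂² = 1`). [folklore] -/
theorem integral_coord_sq_mul_norm_sq : ∫ w, w 0 * w 0 * ‖w‖ ^ 2 ∂stdGaussian V3 = 5 := by
  have hsplit : ∀ w : V3, w 0 * w 0 * ‖w‖ ^ 2 = (w 0) ^ 4 + ((w 0) ^ 2 * (w 1) ^ 2 + (w 0) ^ 2 * (w 2) ^ 2) := by
    intro w; rw [norm_sq_eq_three]; ring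
  have hb : ∀ (w : V3) (j : Fin 3), (w j) ^ 2 ≤ ‖w‖ ^ 2 := fun w j => by
    rw [norm_sq_eq_three]; fin_cases j <;> simp <;> nlinarith [sq_nonneg (w 0), sq_nonneg (w 1), sq_nonneg (w 2)]
  have hi4 : Integrable (fun w : V3 => (w 0) ^ 4) (stdGaussian V3) :=
    integrable_of_le_cube (by fun_prop) 1 fun w => by
      rw [abs_of_nonneg (by positivity)]
      nlinarith [hb w 0, sq_nonneg (w 0), sq_nonneg ‖w‖, sq_nonneg (‖w‖ ^ 2)]
  have hi01 : Integrable (fun w : V3 => (w 0) ^ 2 * (w 1) ^ 2) (stdGaussian V3) :=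
    integrable_of_le_cube (by fun_prop) 1 fun w => by
      rw [abs_of_nonneg (by positivity)]
      nlinarith [hb w 0, hb w 1, sq_nonneg (w 0), sq_nonneg (w 1), sq_nonneg ‖w‖, sq_nonneg (‖w‖ ^ 2),
        mul_nonneg (sq_nonneg (w 0)) (sq_nonneg (w 1))]
  have hi02 : Integrable (fun w : V3 => (w 0) ^ 2 * (w 2) ^ 2) (stdGaussian V3) :=
    integrable_of_le_cube (by fun_prop) 1 fun w => by
      rw [abs_of_nonneg (by positivity)]
      nlinarith [hb w 0, hb w 2, sq_nonneg (w 0), sq_nonneg (w 2), sq_nonneg ‖w‖, sq_nonneg (‖w‖ ^ 2),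
        mul_nonneg (sq_nonneg (w 0)) (sq_nonneg (w 2))]
  have hi012 : Integrable (fun w : V3 => (w 0) ^ 2 * (w 1) ^ 2 + (w 0) ^ 2 * (w 2) ^ 2) (stdGaussian V3) :=
    hi01.add hi02
  simp_rw [hsplit]
  rw [integral_add hi4 hi012, integral_add hi01 hi02, integral_coord_pow_four,
    integral_coord_mul_coord_of_ne (f := fun x => x ^ 2) (g := fun x => x ^ 2) (by decide : (0 : Fin 3) ≠ 1)
      (measurable_id.pow_const 2) (measurable_id.pow_const 2),
    integral_coord_mul_coord_of_ne (f := fun x => x ^ 2) (g := fun x => x ^ 2) (by decide : (0 : Fin 3) ≠ 2)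
      (measurable_id.pow_const 2) (measurable_id.pow_const 2),
    integral_coord_sq_stdGaussian, integral_coord_sq_stdGaussian, integral_coord_sq_stdGaussian]
  norm_num


end KineticCurrentsWindowLDUniformLoadBearing

open KineticCurrentsWindowLDUniformOneSphere KineticCurrentsWindowTilt KineticCurrentsWindowLDUniformLoadBearing
open ShearStressHalfDrudeNonCentred (lintegral_vel_localGibbsMeasure)

/-! ### Variant 1: all `β` -/

/-- **A FALSE proposition — NOT a citable fact.** The crux `OneFlightGossipEngine.KineticCurrentsWindowLDUniform`
(stmt-AtomisticToContinuum-14662) VERBATIM with `∃ β₀ > 0, ∀ β, |β| ≤ β₀ →` strengthened to `∀ β`; kept only as the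
statement that `not_kineticCurrentsWindowLDUniformAllBeta` negates (NO provenance tag on purpose — it is not a fact to vendor or relocate; load-bearing analysis: small `β` is necessary,
and quantitatively `β₀ ≤ 1/(2 sup θ₀ λ_max(A))`). -/
def KineticCurrentsWindowLDUniformAllBeta : Prop :=
  ∃ η₀ : ℝ, 0 < η₀ ∧ ∀ (a θ₀ : Literature.MathematicalPhysics.KineticTheory.T3 → ℝ) (u₀ : Literature.MathematicalPhysics.KineticTheory.T3 → Literature.MathematicalPhysics.KineticTheory.V3), Continuous a → Continuous θ₀ → Continuous u₀ → (∀ x, 0 < a x) → (∀ x, 0 < θ₀ x) → ∀ σ : ℝ, 0 < σ → σ ^ 3 * (⨆ x, a x) ≤ η₀ * ∫ x, a x → ∀ Φ : (N : ℕ) → Literature.Analysis.FluidPDE.HardSphereFlow (Literature.Analysis.FluidPDE.Torus.geometry (Fin 3)) (Literature.MathematicalPhysics.KineticTheory.hsDiameter σ N) (N + 1), ∀ (A : Literature.MathematicalPhysics.KineticTheory.T3 → Fin 3 → Fin 3 → ℝ) (b : Literature.MathematicalPhysics.KineticTheory.T3 → Literature.MathematicalPhysics.KineticTheory.V3) (G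 : Literature.MathematicalPhysics.KineticTheory.T3 × ℝ → ℝ), Continuous A → Continuous b → Continuous G → (∃ C : ℝ, ∀ y : Literature.MathematicalPhysics.KineticTheory.T3 × Literature.MathematicalPhysics.KineticTheory.V3, |(fun y : Literature.MathematicalPhysics.KineticTheory.T3 × Literature.MathematicalPhysics.KineticTheory.V3 => ((∑ j : Fin 3, ∑ k : Fin 3, A y.1 j k * ((y.2 - u₀ y.1) j * (y.2 - u₀ y.1) k)) + (∑ j : Fin 3, b y.1 j * (y.2 - u₀ y.1) j) * G (y.1, ‖y.2 - u₀ y.1‖ ^ 2))) y| ≤ C * (1 + ‖y.2‖ ^ 2)) → (∀ x, ∫ v, (fun y : Literature.MathematicalPhysics.KineticTheory.T3 × Literature.MathematicalPhysics.KineticTheory.V3 => ((∑ j : Fin 3, ∑ k : Fin 3, A y.1 j k * ((y.2 - u₀ y.1) j * (y.2 - u₀ y.1) k)) + (∑ j : Fin 3, b y.1 j * (y.2 - u₀ y.1) j) * G (y.1, ‖y.2 - u₀ y.1‖ ^ 2))) (x, v) * Literature.Analysis.FluidPDE.localMaxwellian 1 (θ₀ x) (u₀ x) v = 0) → (∀ x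 (j : Fin 3), ∫ v, (fun y : Literature.MathematicalPhysics.KineticTheory.T3 × Literature.MathematicalPhysics.KineticTheory.V3 => ((∑ j : Fin 3, ∑ k : Fin 3, A y.1 j k * ((y.2 - u₀ y.1) j * (y.2 - u₀ y.1) k)) + (∑ j : Fin 3, b y.1 j * (y.2 - u₀ y.1) j) * G (y.1, ‖y.2 - u₀ y.1‖ ^ 2))) (x, v) * v j * Literature.Analysis.FluidPDE.localMaxwellian 1 (θ₀ x) (u₀ x) v = 0) → (∀ x, ∫ v, (fun y : Literature.MathematicalPhysics.KineticTheory.T3 × Literature.MathematicalPhysics.KineticTheory.V3 => ((∑ j : Fin 3, ∑ k : Fin 3, A y.1 j k * ((y.2 - u₀ y.1) j * (y.2 - u₀ y.1) k)) + (∑ j : Fin 3, b y.1 j * (y.2 - u₀ y.1) j) * G (y.1, ‖y.2 - u₀ y.1‖ ^ 2))) (x, v) * ‖v‖ ^ 2 * Literature.Analysis.FluidPDE.localMaxwellian 1 (θ₀ x) (u₀ x) v = 0) → ∀ β : ℝ, ∀ ε : ℝ, 0 < ε → ∃ τ : ℝ, 0 < τ ∧ ∃ N₀ : ℕ, ∀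 N : ℕ, N₀ ≤ N → ∫⁻ z, ENNReal.ofReal (Real.exp (β * ∑ i : Fin (N + 1), (τ * ((N : ℝ) + 1) ^ (-(1 / 3 : ℝ)))⁻¹ * ∫ r in (0 : ℝ)..(τ * ((N : ℝ) + 1) ^ (-(1 / 3 : ℝ))), (fun y : Literature.MathematicalPhysics.KineticTheory.T3 × Literature.MathematicalPhysics.KineticTheory.V3 => ((∑ j : Fin 3, ∑ k : Fin 3, A y.1 j k * ((y.2 - u₀ y.1) j * (y.2 - u₀ y.1) k)) + (∑ j : Fin 3, b y.1 j * (y.2 - u₀ y.1) j) * G (y.1, ‖y.2 - u₀ y.1‖ ^ 2))) (((Φ N).flow r z) i))) ∂(Literature.MathematicalPhysics.KineticTheory.localGibbsLaw σ a u₀ θ₀ N (Φ N)) ≤ ENNReal.ofReal (Real.exp (ε * ((N : ℝ) + 1)))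

/-- **THE "FOR EVERY `β`" STRENGTHENING IS FALSE.** Witness: `η₀` arbitrary, `a = θ₀ = 1`, `u₀ = 0`,
`σ = min(1/4, η₀, 1)`, Alexander flows, `F = v₀v₁`, `β = 2`, `ε = 1`: whatever `τ, N₀` are offered, at `N = N₀`
the window functional is `+∞` (`lintegral_exp_shear_window_eq_top`, `2 > 1`), not `≤ e^{N₀+1}`. [folklore] -/
theorem not_kineticCurrentsWindowLDUniformAllBeta : ¬ KineticCurrentsWindowLDUniformAllBeta := by
  rintro ⟨η₀, hη₀, h⟩
  obtain ⟨hσpos, hσ4, -, -⟩ := sigmaOf_spec hη₀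
  have hσhalf : sigmaOf η₀ ≤ 1 / 2 := hσ4.trans (by norm_num)
  have hσhalf' : sigmaOf η₀ < 2⁻¹ := hσ4.trans_lt (by norm_num)
  have hmain := h (fun _ => 1) (fun _ => 1) (fun _ => 0) continuous_const continuous_const
    continuous_const (fun _ => one_pos) (fun _ => one_pos) (sigmaOf η₀) hσpos (guard_sigmaOf hη₀)
    (alexFlow hσpos hσhalf') A01 (fun _ => 0) (fun _ => 0) continuous_const continuous_const continuous_const
  have hmain' : (∃ C : ℝ, ∀ y : T3 × V3, |gShear y.2| ≤ C * (1 + ‖y.2‖ ^ 2)) →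
      (∀ x : T3, ∫ v, gShear v * localMaxwellian 1 1 (0 : V3) v = 0) →
      (∀ (x : T3) (j : Fin 3), ∫ v, gShear v * v j * localMaxwellian 1 1 (0 : V3) v = 0) →
      (∀ x : T3, ∫ v, gShear v * ‖v‖ ^ 2 * localMaxwellian 1 1 (0 : V3) v = 0) →
      ∀ β : ℝ, ∀ ε : ℝ, 0 < ε → ∃ τ : ℝ, 0 < τ ∧ ∃ N₀ : ℕ, ∀ N : ℕ, N₀ ≤ N →
        ∫⁻ z, ENNReal.ofReal (Real.exp (β * ∑ i : Fin (N + 1), (τ * ((N : ℝ) + 1) ^ (-(1 / 3 : ℝ)))⁻¹ *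
          ∫ r in (0 : ℝ)..(τ * ((N : ℝ) + 1) ^ (-(1 / 3 : ℝ))),
            gShear (((alexFlow hσpos hσhalf' N).flow r z) i).2))
          ∂(localGibbsLaw (sigmaOf η₀) (fun _ => 1) (fun _ => 0) (fun _ => 1) N (alexFlow hσpos hσhalf' N)) ≤
        ENNReal.ofReal (Real.exp (ε * ((N : ℝ) + 1))) := by
    simpa only [F_A01] using hmain
  clear hmain h
  obtain ⟨τ, hτ, N₀, hN⟩ := hmain' ⟨1, fun y => abs_gShear_le y.2⟩ (fun _ => gShear_orth_one)
    (fun _ j => gShear_orth_mom j) (fun _ => gShear_orth_energy) 2 1 one_pos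
  have h0 := hN N₀ le_rfl
  have hw : 0 < τ * ((N₀ : ℝ) + 1) ^ (-(1 / 3 : ℝ)) := mul_pos hτ (Real.rpow_pos_of_pos (by positivity) _)
  have htop := lintegral_exp_shear_window_eq_top hσhalf (alexFlow hσpos hσhalf' N₀) hw (β := 2) (by norm_num)
  have hle : (⊤ : ℝ≥0∞) ≤ ENNReal.ofReal (Real.exp (1 * ((N₀ : ℝ) + 1))) := le_of_eq_of_le htop.symm h0
  exact absurd hle (not_le.2 ENNReal.ofReal_lt_top)

/-! ### Variant 2: no orthogonality to `v_j` -/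

/-- **A FALSE proposition — NOT a citable fact.** The crux `OneFlightGossipEngine.KineticCurrentsWindowLDUniform`
(stmt-AtomisticToContinuum-14662) VERBATIM with the hypothesis `∀ x j, ∫ F(x,v) v_j M_{1,u₀(x),θ₀(x)}(v) dv = 0`
DELETED; kept only as the statement that `not_kineticCurrentsWindowLDUniformWithoutOrthMom` negates (load-bearing
analysis: orthogonality to the momentum invariants is necessary). -/
def KineticCurrentsWindowLDUniformWithoutOrthMom : Prop :=
  ∃ η₀ : ℝ, 0 < η₀ ∧ ∀ (a θ₀ : Literature.MathematicalPhysics.KineticTheory.T3 → ℝ) (u₀ : Literature.MathematicalPhysics.KineticTheory.T3 → Literature.MathematicalPhysics.KineticTheory.V3), Continuous a → Continuous θ₀ → Continuous u₀ → (∀ x, 0 < a x) → (∀ x, 0 < θ₀ x) → ∀ σ : ℝ, 0 < σ → σ ^ 3 * (⨆ x, a x) ≤ η₀ * ∫ x, a x → ∀ Φ : (N : ℕ) → Literature.Analysis.FluidPDE.HardSphereFlow (Literature.Analysis.FluidPDE.Torus.geometry (Fin 3)) (Literature.MathematicalPhysics.KineticTheory.hsDiameter σ N) (N + 1), ∀ (A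 : Literature.MathematicalPhysics.KineticTheory.T3 → Fin 3 → Fin 3 → ℝ) (b : Literature.MathematicalPhysics.KineticTheory.T3 → Literature.MathematicalPhysics.KineticTheory.V3) (G : Literature.MathematicalPhysics.KineticTheory.T3 × ℝ → ℝ), Continuous A → Continuous b → Continuous G → (∃ C : ℝ, ∀ y : Literature.MathematicalPhysics.KineticTheory.T3 × Literature.MathematicalPhysics.KineticTheory.V3, |(fun y : Literature.MathematicalPhysics.KineticTheory.T3 × Literature.MathematicalPhysics.KineticTheory.V3 => ((∑ j : Fin 3, ∑ k : Fin 3, A y.1 j k * ((y.2 - u₀ y.1) j * (y.2 - u₀ y.1) k)) + (∑ j : Fin 3, b y.1 j * (y.2 - u₀ y.1) j) * G (y.1, ‖y.2 - u₀ y.1‖ ^ 2))) y| ≤ C * (1 + ‖y.2‖ ^ 2)) → (∀ x, ∫ v, (fun y : Literature.MathematicalPhysics.KineticTheory.T3 × Literature.MathematicalPhysics.KineticTheory.V3 => ((∑ j : Fin 3, ∑ k : Fin 3, A y.1 j k * ((y.2 - u₀ y.1) j * (y.2 - u₀ y.1) k)) + (∑ j : Fin 3, b y.1 j * (y.2 -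 u₀ y.1) j) * G (y.1, ‖y.2 - u₀ y.1‖ ^ 2))) (x, v) * Literature.Analysis.FluidPDE.localMaxwellian 1 (θ₀ x) (u₀ x) v = 0) → (∀ x, ∫ v, (fun y : Literature.MathematicalPhysics.KineticTheory.T3 × Literature.MathematicalPhysics.KineticTheory.V3 => ((∑ j : Fin 3, ∑ k : Fin 3, A y.1 j k * ((y.2 - u₀ y.1) j * (y.2 - u₀ y.1) k)) + (∑ j : Fin 3, b y.1 j * (y.2 - u₀ y.1) j) * G (y.1, ‖y.2 - u₀ y.1‖ ^ 2))) (x, v) * ‖v‖ ^ 2 * Literature.Analysis.FluidPDE.localMaxwellian 1 (θ₀ x) (u₀ x) v = 0) → ∃ β₀ : ℝ, 0 < β₀ ∧ ∀ β : ℝ, |β| ≤ β₀ → ∀ ε : ℝ, 0 < ε → ∃ τ : ℝ, 0 < τ ∧ ∃ N₀ : ℕ, ∀ N : ℕ, N₀ ≤ N → ∫⁻ z, ENNReal.ofReal (Real.exp (β * ∑ i : Fin (N + 1), (τ * ((N : ℝ) + 1) ^ (-(1 / 3 : ℝ)))⁻¹ * ∫ r in (0 : ℝ)..(τ * ((N :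 ℝ) + 1) ^ (-(1 / 3 : ℝ))), (fun y : Literature.MathematicalPhysics.KineticTheory.T3 × Literature.MathematicalPhysics.KineticTheory.V3 => ((∑ j : Fin 3, ∑ k : Fin 3, A y.1 j k * ((y.2 - u₀ y.1) j * (y.2 - u₀ y.1) k)) + (∑ j : Fin 3, b y.1 j * (y.2 - u₀ y.1) j) * G (y.1, ‖y.2 - u₀ y.1‖ ^ 2))) (((Φ N).flow r z) i))) ∂(Literature.MathematicalPhysics.KineticTheory.localGibbsLaw σ a u₀ θ₀ N (Φ N)) ≤ ENNReal.ofReal (Real.exp (ε * ((N : ℝ) + 1)))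

/-- **ORTHOGONALITY TO `v_j` IS LOAD-BEARING**: without it the crux is false. Witness: `η₀` arbitrary, `a = θ₀ = 1`,
`u₀ = 0`, `σ = min(1/4, η₀, 1)`, Alexander flows, `A = 0`, `b = e₀`, `G = 1` (`F = v₀`): given the offered `β₀ > 0`
take `β = β₀`, `ε = β₀²/4`; whatever `τ, N₀`, at `N = N₀` the functional is `≥ e^{(N₀+1)β₀²/2} > e^{(N₀+1)β₀²/4}`
(`exp_le_lintegral_exp_momentum_window`). [folklore] -/
theorem not_kineticCurrentsWindowLDUniformWithoutOrthMom : ¬ KineticCurrentsWindowLDUniformWithoutOrthMom := by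
  rintro ⟨η₀, hη₀, h⟩
  obtain ⟨hσpos, hσ4, -, -⟩ := sigmaOf_spec hη₀
  have hσhalf : sigmaOf η₀ ≤ 1 / 2 := hσ4.trans (by norm_num)
  have hσhalf' : sigmaOf η₀ < 2⁻¹ := hσ4.trans_lt (by norm_num)
  have hmain := h (fun _ => 1) (fun _ => 1) (fun _ => 0) continuous_const continuous_const
    continuous_const (fun _ => one_pos) (fun _ => one_pos) (sigmaOf η₀) hσpos (guard_sigmaOf hη₀)
    (alexFlow hσpos hσhalf') A0 bE0 G1 continuous_const continuous_const continuous_const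
  have hmain' : (∃ C : ℝ, ∀ y : T3 × V3, |y.2 0| ≤ C * (1 + ‖y.2‖ ^ 2)) →
      (∀ x : T3, ∫ v, v 0 * localMaxwellian 1 1 (0 : V3) v = 0) →
      (∀ x : T3, ∫ v, v 0 * ‖v‖ ^ 2 * localMaxwellian 1 1 (0 : V3) v = 0) →
      ∃ β₀ : ℝ, 0 < β₀ ∧ ∀ β : ℝ, |β| ≤ β₀ → ∀ ε : ℝ, 0 < ε → ∃ τ : ℝ, 0 < τ ∧ ∃ N₀ : ℕ, ∀ N : ℕ, N₀ ≤ N →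
        ∫⁻ z, ENNReal.ofReal (Real.exp (β * ∑ i : Fin (N + 1), (τ * ((N : ℝ) + 1) ^ (-(1 / 3 : ℝ)))⁻¹ *
          ∫ r in (0 : ℝ)..(τ * ((N : ℝ) + 1) ^ (-(1 / 3 : ℝ))),
            (((alexFlow hσpos hσhalf' N).flow r z) i).2 0))
          ∂(localGibbsLaw (sigmaOf η₀) (fun _ => 1) (fun _ => 0) (fun _ => 1) N (alexFlow hσpos hσhalf' N)) ≤
        ENNReal.ofReal (Real.exp (ε * ((N : ℝ) + 1))) := by
    simpa only [F_mom] using hmain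
  clear hmain h
  obtain ⟨β₀, hβ₀, hβ⟩ := hmain' ⟨1, fun y => abs_coord_le y.2⟩ (fun _ => coord_orth_one)
    (fun _ => coord_orth_energy)
  obtain ⟨τ, hτ, N₀, hN⟩ := hβ β₀ (by rw [abs_of_pos hβ₀]) (β₀ ^ 2 / 4) (by positivity)
  have h0 := hN N₀ le_rfl
  have hw : 0 < τ * ((N₀ : ℝ) + 1) ^ (-(1 / 3 : ℝ)) := mul_pos hτ (Real.rpow_pos_of_pos (by positivity) _)
  have hlow := exp_le_lintegral_exp_momentum_window hσhalf (alexFlow hσpos hσhalf' N₀) hw β₀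
  have hle : ENNReal.ofReal (Real.exp (((N₀ : ℝ) + 1) * (β₀ ^ 2 / 2))) ≤
      ENNReal.ofReal (Real.exp (β₀ ^ 2 / 4 * ((N₀ : ℝ) + 1))) := hlow.trans h0
  rw [ENNReal.ofReal_le_ofReal_iff (Real.exp_pos _).le, Real.exp_le_exp] at hle
  have hN1 : (0 : ℝ) < (N₀ : ℝ) + 1 := by positivity
  nlinarith [hle, hβ₀, mul_pos hN1 (pow_pos hβ₀ 2)]

end Summit.AtomisticToContinuum.HydrodynamicLimit.Theorems

end
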